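import Mathlib

/-!
# The Jordan block `J₃` (with passengers) has order `3` exactly in characteristic `3` (rung V3, step V3-S1)

(crux stmt-ResolutionOfSingularities-15640 `WildQuotients.WildQuotientResolution`, line `Sketch`,
sector `|G| = p`; rung V3 of `L/w45c/CHAIN.md` v4 / candidate V3-S1 `v3_order_charThree` of
`L/w45c/W45cPlanSignaturesV4.lean` (planner res-L1-w45c-plan-1), signature verbatim;
[OURS · L1 W4.5c] — NOT a statement of any manuscript; replaces the role of no printed item.)

The `k`-algebra automorphism `σ` of `k[x₀,…,x_{n-1}]` given ABSTRACTLY by the `J₃` law on three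
distinct coordinates `a, b, c` — `σ x_b = x_b + x_a`, `σ x_c = x_c + x_b`, `σ xᵢ = xᵢ` for every other
`i` (in particular `σ x_a = x_a`): the iterates are `σᵐ x_b = x_b + m x_a`,
`σᵐ x_c = x_c + m x_b + (m choose 2) x_a`, so over a field of characteristic `3` (`3 = 0`,
`(3 choose 2) = 3 = 0`) `σ ^ 3 = 1`, `σ ≠ 1`, and `Subgroup.zpowers σ` has exactly `3` elements.
(For `p ≥ 5` the same datum has order `p`; only `p = 3` is used by rung V3.)
Model: `TwoBlocks.stub_twoBlocks_order`, `JordanBlock.jordanBlock_order`.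
-/

-- single-problem summit: the doubled namespace component `ResolutionOfSingularities` is forced
set_option linter.dupNamespace false

noncomputable section

open MvPolynomial

namespace Summit.ResolutionOfSingularities.ResolutionOfSingularities.Theorems.WildQuotientResolution.JordanThree

variable (k : Type) [Field k] (n : ℕ) (σ : MvPolynomial (Fin n) k ≃ₐ[k] MvPolynomial (Fin n) k)
  (a b c : Fin n) (hab : a ≠ b) (hac : a ≠ c)
  (hb : σ (X b) = X b + X a) (hc : σ (X c) = X c + X b)
  (hσ : ∀ i, i ≠ b → i ≠ c → σ (X i) = X i)

/-! ## Iterates -/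

include hσ in
/-- `σᵐ xᵢ = xᵢ` for the passenger coordinates `i ≠ b, c` (in particular `i = a`). [folklore] -/
theorem pow_apply_X_of_ne (m : ℕ) (i : Fin n) (hib : i ≠ b) (hic : i ≠ c) :
    (σ ^ m) (X i) = X i := by
  induction m with
  | zero => simp
  | succ m ih => rw [pow_succ', AlgEquiv.mul_apply, ih, hσ i hib hic]

include hab hac hb hσ in
/-- `σᵐ x_b = x_b + m x_a`. [folklore] -/
theorem pow_apply_X_b (m : ℕ) :
    (σ ^ m) (X b) = X b + (m : MvPolynomial (Fin n) k) * X a := by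
  induction m with
  | zero => simp
  | succ m ih =>
    rw [pow_succ', AlgEquiv.mul_apply, ih, map_add, map_mul, map_natCast, hb, hσ a hab hac]
    push_cast
    ring

include hab hac hb hc hσ in
/-- `σᵐ x_c = x_c + m x_b + (m choose 2) x_a`. [folklore] -/
theorem pow_apply_X_c (m : ℕ) :
    (σ ^ m) (X c) = X c + (m : MvPolynomial (Fin n) k) * X b +
      ((m.choose 2 : ℕ) : MvPolynomial (Fin n) k) * X a := by
  induction m with
  | zero => simp
  | succ m ih =>
    rw [pow_succ', AlgEquiv.mul_apply, ih, map_add, map_add, map_mul, map_mul, map_natCast,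
      map_natCast, hc, hb, hσ a hab hac, Nat.choose_succ_succ', Nat.choose_one_right]
    push_cast
    ring

/-! ## Order -/

include hab hac hb hc hσ in
/-- **`σ ^ 3 = 1` in characteristic `3`** (check on the generators: `3 = 0` and `(3 choose 2) = 3 = 0`
in `k`). [folklore] -/
theorem pow_three_eq_one [CharP k 3] : σ ^ 3 = 1 := by
  classical
  have h3 : ((3 : ℕ) : MvPolynomial (Fin n) k) = 0 := CharP.cast_eq_zero _ 3
  have key : ((σ ^ 3 : MvPolynomial (Fin n) k ≃ₐ[k] MvPolynomial (Fin n) k) :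
      MvPolynomial (Fin n) k →ₐ[k] MvPolynomial (Fin n) k) = AlgHom.id k _ := by
    refine MvPolynomial.algHom_ext fun i => ?_
    change (σ ^ 3) (X i) = X i
    by_cases hib : i = b
    · subst hib
      rw [pow_apply_X_b k n σ a i c hab hac hb hσ 3, h3, zero_mul, add_zero]
    by_cases hic : i = c
    · subst hic
      rw [pow_apply_X_c k n σ a b i hab hac hb hc hσ 3]
      have h32 : (((3 : ℕ).choose 2 : ℕ) : MvPolynomial (Fin n) k) = 0 := by
        rw [show (3 : ℕ).choose 2 = 3 by decide]; exact h3
      rw [h3, h32, zero_mul, zero_mul, add_zero, add_zero]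
    · exact pow_apply_X_of_ne k n σ b c hσ 3 i hib hic
  apply AlgEquiv.ext
  intro r
  have := DFunLike.congr_fun key r
  simpa using this

include hb in
/-- **`σ ≠ 1`** (`σ x_b = x_b + x_a ≠ x_b`). [folklore] -/
theorem ne_one : σ ≠ 1 := by
  intro h
  have h1 := hb
  rw [h, AlgEquiv.one_apply] at h1
  have hX : (X a : MvPolynomial (Fin n) k) = 0 := by
    have := congrArg (fun g => g - X b) h1
    simp only [sub_self, add_sub_cancel_left] at this
    exact this.symm
  exact MvPolynomial.X_ne_zero _ hX

include hab hac hb hc hσ in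
/-- **`|⟨σ⟩| = 3`** in characteristic `3`. [folklore] -/
theorem card_zpowers_charThree [CharP k 3] : Nat.card (Subgroup.zpowers σ) = 3 := by
  haveI : Fact (Nat.Prime 3) := ⟨Nat.prime_three⟩
  rw [Nat.card_zpowers, orderOf_eq_prime (pow_three_eq_one k n σ a b c hab hac hb hc hσ)
    (ne_one k n σ a b hb)]

/-- **V3-S1 `v3_order_charThree`** (candidate of `W45cPlanSignaturesV4.lean`, signature verbatim;
[OURS · L1 W4.5c]): the `J₃` datum `σ x_b = x_b + x_a`, `σ x_c = x_c + x_b`, identity on every other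
coordinate (`a, b, c` distinct) has `σ ^ 3 = 1` and `σ ≠ 1` over a field of characteristic `3`
(`σᵐ x_c = x_c + m x_b + (m choose 2) x_a`). The hypothesis `b ≠ c` is part of the registered law
and is not needed for the conclusion. NOT a statement of the manuscript. [folklore] -/
theorem v3_order_charThree (k : Type) [Field k] [CharP k 3] (n : ℕ)
    (σ : MvPolynomial (Fin n) k ≃ₐ[k] MvPolynomial (Fin n) k) (a b c : Fin n)
    (hab : a ≠ b) (_hbc : b ≠ c) (hac : a ≠ c)
    (hb : σ (X b) = X b + X a) (hc : σ (X c) = X c + X b)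
    (hσ : ∀ i, i ≠ b → i ≠ c → σ (X i) = X i) :
    σ ^ 3 = 1 ∧ σ ≠ 1 :=
  ⟨pow_three_eq_one k n σ a b c hab hac hb hc hσ, ne_one k n σ a b hb⟩

end Summit.ResolutionOfSingularities.ResolutionOfSingularities.Theorems.WildQuotientResolution.JordanThree

end
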